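import Mathlib
import Literature.MathematicalPhysics.KineticTheory.HardSphereEuler
import Literature.Dynamics.Billiards.URegularState

/-!
# Sketch — crux `CollisionRate` (stmt-AtomisticToContinuum-13481), idea card
`unstable-inheritance-clock-compensator` (crux-ideate round 1, ideator 1)

First lemmas of the line, stated over existing declarations (no proofs required at this stage;
`InheritanceIdentity` and `LaggedCompensatorBound` are provable now from Mathlib,
`PlaqueTiltOscillation` is one line from `mem_localUnstableSet_iff`).

* `InheritanceIdentity` — (UG-a, exact Bayes form) a density that is measurable with respect to a
  sub-σ-algebra does not change conditional expectations given that σ-algebra.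
* `InheritanceDistortion` — the quantitative form actually used: a density that oscillates by at
  most `e^{±Δ}` around its conditional mean changes conditional expectations of nonnegative
  observables by at most `e^{±2Δ}`.
* `PlaqueTiltOscillation` — hard-ball typed input of the distortion form: on a measurable
  partition subordinate to the time-`t` local unstable sets of size `δ` of the hard-sphere flow,
  the log-density `Σᵢ ψ(xᵢ, vᵢ) ∘ Φ₋ₜ` of the EVOLVED local Gibbs law relative to the invariant
  canonical law oscillates on atoms by at most `(N+1)·ω(δ)`, `ω` a modulus of the one-body tilt
  `ψ` — because backward orbits inside a local unstable set stay `δ`-close at all times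
  (`Billiards.mem_localUnstableSet_iff`), with NO hyperbolicity estimate.
* `LaggedCompensatorBound` — the fluctuation half of the line: for a filtration `ℱ` and random
  variables `c w` that are `ℱ (w+2)`-measurable, `E (Σ_w (c w − E[c w | ℱ w]))² ≤ 4 Σ_w E (c w)²`
  (orthogonality of lag-1 and lag-2 martingale differences).
-/

open MeasureTheory ProbabilityTheory Filter Set
open scoped ENNReal

namespace Summit.AtomisticToContinuum.HydrodynamicLimit.Cruxes.CollisionRate.UnstableInheritance

/-- (UG-a, exact form) **Inheritance of conditional expectations under an `m`-measurable change of
density.** If `μ = G.withDensity f` with `f` measurable for the sub-σ-algebra `m`, then for every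
`G`- and `μ`-integrable `g`, `μ[g | m] = G[g | m]` `μ`-a.e. (Bayes' rule for conditional
expectations: `E_μ[g|m] = E_G[fg|m]/E_G[f|m] = E_G[g|m]` because `f` pulls out). -/
def InheritanceIdentity : Prop :=
  ∀ (Ω : Type) [MeasurableSpace Ω] (m : MeasurableSpace Ω) (G : Measure Ω) [IsFiniteMeasure G]
    (f : Ω → ℝ≥0∞) (g : Ω → ℝ),
    m ≤ ‹MeasurableSpace Ω› → Measurable[m] f → ∫⁻ x, f x ∂G ≠ ∞ →
    Integrable g G → Integrable g (G.withDensity f) →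
    (G.withDensity f)[g|m] =ᵐ[G.withDensity f] G[g|m]

/-- (UG-a, distortion form) If the density `f = dμ/dG` stays within `e^{±Δ}` of its own
`G`-conditional mean given `m` (i.e. `log f` oscillates by at most `Δ` on the atoms of `m`), then
`μ`- and `G`-conditional expectations of every nonnegative bounded measurable `g` agree within
`e^{±2Δ}`, `μ`-almost everywhere. -/
def InheritanceDistortion : Prop :=
  ∀ (Ω : Type) [MeasurableSpace Ω] (m : MeasurableSpace Ω) (G : Measure Ω) [IsProbabilityMeasure G]
    (f : Ω → ℝ) (Δ : ℝ),
    m ≤ ‹MeasurableSpace Ω› → 0 ≤ Δ → Measurable f → (∀ x, 0 < f x) → ∫ x, f x ∂G = 1 →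
    (∀ᵐ x ∂G, Real.exp (-Δ) * (G[f|m]) x ≤ f x ∧ f x ≤ Real.exp Δ * (G[f|m]) x) →
    ∀ g : Ω → ℝ, Measurable g → (∀ x, 0 ≤ g x) → (∃ C : ℝ, ∀ x, g x ≤ C) →
      let μ : Measure Ω := G.withDensity fun x => ENNReal.ofReal (f x)
      ∀ᵐ x ∂μ, Real.exp (-(2 * Δ)) * (G[g|m]) x ≤ (μ[g|m]) x ∧
        (μ[g|m]) x ≤ Real.exp (2 * Δ) * (G[g|m]) x

open Literature.MathematicalPhysics.KineticTheory Literature.Analysis.FluidPDE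
  Literature.Dynamics.Billiards

/-- The one-body log-tilt of the local Gibbs profile `(a₀, u₀, θ₀)` relative to the constant
profile `(1, 0, 1)`: `ψ(x, v) = log a₀(x) − (3/2) log θ₀(x) − |v − u₀(x)|²/(2θ₀(x)) + |v|²/2`, so
that on the hard-sphere domain `d LG(a₀,u₀,θ₀) / d LG(1,0,1) = Z⁻¹ exp (Σᵢ ψ(xᵢ, vᵢ))`
(`localGibbsProfile`, `localMaxwellian`). -/
noncomputable def oneBodyTilt (a₀ : T3 → ℝ) (u₀ : T3 → V3) (θ₀ : T3 → ℝ) (p : T3 × V3) : ℝ :=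
  Real.log (a₀ p.1) - 3 / 2 * Real.log (θ₀ p.1) - ‖p.2 - u₀ p.1‖ ^ 2 / (2 * θ₀ p.1) + ‖p.2‖ ^ 2 / 2

/-- The `N`-body log-tilt `Σᵢ ψ(zᵢ)`. -/
noncomputable def logTilt {N : ℕ} (a₀ : T3 → ℝ) (u₀ : T3 → V3) (θ₀ : T3 → ℝ)
    (z : Config N (Fin 3) T3) : ℝ :=
  ∑ i, oneBodyTilt a₀ u₀ θ₀ (z i)

/-- (UG-b input, typed over the tree's hard-ball unstable sets) **Plaque oscillation of the
pulled-back tilt.** If a measurable partition `ξ` of `(N+1)`-sphere phase space has its atom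
through `Φₜ z` inside the local unstable set `W^u_δ(Φₜ z)` of the hard-sphere flow (subordinate to
the unstable plaques AT TIME `t`), and the one-body tilt `ψ` has modulus `ω` at scale `δ` on the
set of one-particle states visited, then the log-density of the evolved local Gibbs law
`(Φₜ)_# LG` relative to the invariant canonical law, `logTilt ∘ Φ₋ₜ`, oscillates on that atom by
at most `(N+1)·ω`: backward orbits in a local unstable set are `δ`-close at ALL times
(`mem_localUnstableSet_iff`), in the sup-product metric, so each of the `N+1` one-body terms
moves by at most `ω`. No hyperbolicity is used; hyperbolicity enters the line only through the
EXISTENCE of such partitions with absolutely continuous conditionals (`HardSphereFlow.IsUGibbs`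
of the canonical law: Sinai–Chernov 1987, Katok–Strelcyn 1986). -/
def PlaqueTiltOscillation : Prop :=
  ∀ (σ : ℝ) (N : ℕ)
    (Φ : HardSphereFlow (Torus.geometry (Fin 3)) (hsDiameter σ N) (N + 1))
    (a₀ θ₀ : T3 → ℝ) (u₀ : T3 → V3) (δ ω t : ℝ) (S : Set (T3 × V3)),
    0 ≤ δ → 0 ≤ t →
    (∀ p ∈ S, ∀ q ∈ S, dist p q ≤ δ → |oneBodyTilt a₀ u₀ θ₀ p - oneBodyTilt a₀ u₀ θ₀ q| ≤ ω) →
    ∀ (y z : Config (N + 1) (Fin 3) T3),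
      y ∈ Φ.localUnstableSet δ z →
      (∀ i, Φ.flow (-t) y i ∈ S) → (∀ i, Φ.flow (-t) z i ∈ S) →
      |logTilt a₀ u₀ θ₀ (Φ.flow (-t) y) - logTilt a₀ u₀ θ₀ (Φ.flow (-t) z)| ≤ (N + 1) * ω

/-- (S2, fluctuation half) **Lagged-compensator `L²` bound.** For a filtration `ℱ` on a
probability space and square-integrable `c w` measurable with respect to `ℱ (w + 2)`,
`∫ (Σ_{w<K} (c w − μ[c w | ℱ w]))² dμ ≤ 4 Σ_{w<K} ∫ (c w)² dμ`: write
`c w − E[c w|ℱ w] = (E[c w|ℱ (w+2)] − E[c w|ℱ (w+1)]) + (E[c w|ℱ (w+1)] − E[c w|ℱ w])`, two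
families of martingale differences, each orthogonal across `w`, each term of second moment
`≤ E (c w)²`. Applied with `c w = (ε/(N+1))·(χ g-weighted collision count of window w)` and
`ℱ w` the σ-algebra of the time-`t_w` unstable partition, it kills the fluctuation of the crux's
statistic about its u-compensator with NO fixed-time variance input:
`4 (ε/(N+1))² Σ_w E n_w² ≲ σ² K N^{-1/3} → 0`. -/
def LaggedCompensatorBound : Prop :=
  ∀ (Ω : Type) [mΩ : MeasurableSpace Ω] (μ : Measure Ω) [IsProbabilityMeasure μ]
    (ℱ : Filtration ℕ mΩ) (c : ℕ → Ω → ℝ) (K : ℕ),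
    (∀ w, StronglyMeasurable[ℱ (w + 2)] (c w)) → (∀ w, MemLp (c w) 2 μ) →
    ∫ x, (∑ w ∈ Finset.range K, (c w x - (μ[c w|ℱ w]) x)) ^ 2 ∂μ
      ≤ 4 * ∑ w ∈ Finset.range K, ∫ x, (c w x) ^ 2 ∂μ

/-- Sanity: the local-unstable-set hypothesis of `PlaqueTiltOscillation` gives `δ`-closeness of
backward orbits at all nonnegative times, by definition (this is the whole dynamical content of
the inheritance step). -/
theorem dist_flow_neg_le_of_mem_localUnstableSet {σ : ℝ} {N : ℕ}
    (Φ : HardSphereFlow (Torus.geometry (Fin 3)) (hsDiameter σ N) (N + 1))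
    {δ t : ℝ} (ht : 0 ≤ t) {y z : Config (N + 1) (Fin 3) T3}
    (hy : y ∈ Φ.localUnstableSet δ z) :
    dist (Φ.flow (-t) y) (Φ.flow (-t) z) ≤ δ := by
  rw [HardSphereFlow.localUnstableSet_eq, Literature.Dynamics.Billiards.mem_localUnstableSet_iff] at hy
  exact hy.2 t ht

end Summit.AtomisticToContinuum.HydrodynamicLimit.Cruxes.CollisionRate.UnstableInheritance
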